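import Mathlib.RepresentationTheory.Irreducible
import Mathlib.LinearAlgebra.Charpoly.BaseChange
import Mathlib.LinearAlgebra.Eigenspace.Charpoly
import Mathlib.LinearAlgebra.FiniteDimensional.Lemmas
import Mathlib.FieldTheory.Finiteness
import Mathlib.Algebra.Module.ZMod
import Mathlib.Algebra.Field.ZMod
import HarnessLib

/-!
# A plane representation all of whose elements fix a non-zero vector has an invariant line

Topic `Literature/RepresentationTheory/FiniteGroups`. An elementary substitute, in dimension
`2`, for the Brauer–Nesbitt step of the standard argument "Eisenstein Frobenius traces force a
reducible residual representation" (Darmon–Diamond–Taylor, *Fermat's Last Theorem*, Current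
Developments in Math. 1995, Prop. 2.6(b): a semisimple mod `ℓ` representation of `G_ℚ` is
determined by the characteristic polynomials of Frobenius — proof: Chebotarev density and the
Brauer–Nesbitt theorem, Curtis–Reiner (30.16)), in the form consumed by the named fact
`Literature.NumberTheory.EllipticCurves.not_irreducible_of_frobeniusTrace_congr` of
`Literature.NumberTheory.EllipticCurves.ModPReducibility` (if `p ∣ #Ẽ(𝔽_ℓ)` for all good
`ℓ ≠ p` then `E[p]` is reducible): there, every Frobenius element — hence, by Chebotarev, every
element of the image of `ρ̄_{E,p}` — fixes a non-zero vector of `E[p] ≅ 𝔽_p²` (a reduction of an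
`𝔽_ℓ`-rational `p`-torsion point), and the present file supplies the purely group-theoretic
conclusion.

## Main results (all proved; no named facts)

* `Literature.RepresentationTheory.FiniteGroups.Representation.exists_finrank_eq_one_invariant_of_forall_exists_fixed`: let `k` be a
  field, `V` a `k`-vector space of dimension `2` and `ρ : G →* GL(V)` a representation of a group
  `G` (Mathlib `Representation k G V`). If every `ρ g` has a non-zero fixed vector (i.e. `1` is an
  eigenvalue of every element of the image), then some line `L ⊆ V` is stable under all `ρ g`.
* `exists_ne_bot_ne_top_invariant_of_forall_exists_fixed`, `not_isIrreducible_of_forall_exists_fixed`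
  (the same with `L ≠ ⊥, ⊤`, and as `¬ ρ.IsIrreducible` for Mathlib's `Subrepresentation` order);
* `exists_stable_addSubgroup_of_forall_exists_fixed` (the Galois-module form: a group `Γ` acting
  by additive automorphisms on an `𝔽_p`-vector space `A` of dimension `2` — e.g. `A = E[p]`, cf.
  `WeierstrassCurve.HasIrreducibleModPGaloisRep` — such that every `σ ∈ Γ` fixes a non-zero
  element admits a `Γ`-stable subgroup other than `⊥` and `⊤`), with
  `finrank_eq_two_of_natCard_eq_sq` (`#A = p² ⇒ dim_{𝔽_p} A = 2`, to be fed with the tree's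
  `WeierstrassCurve.card_torsionBy_eq_sq`).

## Proof

No semisimplification is needed in dimension `2`; the hypothesis "`1` is an eigenvalue of every
element" is used for products of two elements of the image:

* (`apply_mem_ker_of_unipotent`) if the image contains a unipotent `u = 1 + N ≠ 1` (`N² = 0`, so
  `L := ker N = im N` is a line), then `L` is stable: otherwise some `g` moves `L` to a line
  `M = gL ≠ L`, the conjugate `u' = g u g⁻¹ = 1 + N'` has `ker N' = im N' = M`, and a fixed vector
  `v ≠ 0` of `u u' = 1 + N + N' + N N'` satisfies `N v + N' v + N N' v = 0`; applying `N` gives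
  `N N' v = 0`, so `N' v ∈ L ∩ M = 0`, then `N v = 0`, so `v ∈ L ∩ M = 0` — a contradiction (in
  coordinates: `u u' = (1 + ab, a; b, 1)` has characteristic polynomial `X² - (2 + ab)X + 1`,
  which does not vanish at `1` when `ab ≠ 0`);
* (`mul_self_sub_one_eq_zero_of_det_eq_one`, `exists_finrank_eq_one_invariant_of_forall_ne`)
  otherwise every element `g` of the image with `det g = 1` is trivial — its characteristic
  polynomial is monic of degree `2` with constant term `det g = 1` and root `1`, hence `(X - 1)²`,
  and Cayley–Hamilton makes `g` unipotent — so all commutators of the image are trivial, the image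
  is abelian, and the fixed line `ker(g₀ - 1)` of any non-trivial `g₀` in the image is stable
  (any line if the image is trivial).

## References

* C. W. Curtis, I. Reiner, *Representation theory of finite groups and associative algebras*,
  Wiley 1962, (30.16) (Brauer–Nesbitt theorem).
* H. Darmon, F. Diamond, R. Taylor, *Fermat's Last Theorem*, Current Developments in Mathematics
  1995, International Press, Prop. 2.6(b).
* J.-P. Serre, *Propriétés galoisiennes des points d'ordre fini des courbes elliptiques*, Invent.
  Math. 15 (1972), §2 (subgroups of `GL₂(𝔽_p)`).
-/

open Module Polynomial

namespace Literature.RepresentationTheory.FiniteGroups.Representation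

variable {k V G : Type*} [Field k] [AddCommGroup V] [Module k V] [Group G]

/-! ### Lines in a plane -/

section Lines

/-- Two lines of a finite-dimensional vector space with a common non-zero vector coincide (both
equal the span of that vector). [folklore] -/
theorem eq_of_finrank_eq_one_of_mem [FiniteDimensional k V] {L M : Submodule k V}
    (hL : finrank k L = 1) (hM : finrank k M = 1) {x : V} (hx : x ≠ 0) (hxL : x ∈ L)
    (hxM : x ∈ M) : L = M := by
  have h1 : (k ∙ x) = L :=
    Submodule.eq_of_le_of_finrank_eq ((Submodule.span_singleton_le_iff_mem x L).mpr hxL)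
      (by rw [finrank_span_singleton hx, hL])
  have h2 : (k ∙ x) = M :=
    Submodule.eq_of_le_of_finrank_eq ((Submodule.span_singleton_le_iff_mem x M).mpr hxM)
      (by rw [finrank_span_singleton hx, hM])
  rw [← h1, h2]

/-- In a plane, a non-zero endomorphism `N` with `N² = 0` has `im N = ker N`, a line
(rank–nullity: `dim im N + dim ker N = 2`, `0 < dim im N ≤ dim ker N`). [folklore] -/
theorem range_eq_ker_of_mul_self_eq_zero (h2 : finrank k V = 2) {N : Module.End k V} (hN : N ≠ 0)
    (hsq : N * N = 0) :
    LinearMap.range N = LinearMap.ker N ∧ finrank k (LinearMap.ker N) = 1 := by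
  haveI : FiniteDimensional k V := Module.finite_of_finrank_eq_succ h2
  have hle : LinearMap.range N ≤ LinearMap.ker N := by
    rintro _ ⟨y, rfl⟩
    rw [LinearMap.mem_ker, ← Module.End.mul_apply, hsq, LinearMap.zero_apply]
  have hsum := LinearMap.finrank_range_add_finrank_ker N
  rw [h2] at hsum
  have hmono : finrank k (LinearMap.range N) ≤ finrank k (LinearMap.ker N) :=
    Submodule.finrank_mono hle
  have hpos : finrank k (LinearMap.range N) ≠ 0 := by
    rw [Ne, Submodule.finrank_eq_zero, LinearMap.range_eq_bot]
    exact hN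
  have hker : finrank k (LinearMap.ker N) = 1 := by omega
  exact ⟨Submodule.eq_of_le_of_finrank_eq hle (by omega), hker⟩

/-- A submodule of a plane which is neither `⊥` nor `⊤` is a line. [folklore] -/
theorem finrank_eq_one_of_ne_bot_of_ne_top (h2 : finrank k V = 2) {L : Submodule k V}
    (hbot : L ≠ ⊥) (htop : L ≠ ⊤) : finrank k L = 1 := by
  haveI : FiniteDimensional k V := Module.finite_of_finrank_eq_succ h2
  have hle : finrank k L ≤ 2 := h2 ▸ Submodule.finrank_le L
  have h0 : finrank k L ≠ 0 := by rwa [Ne, Submodule.finrank_eq_zero]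
  have h2' : finrank k L ≠ 2 := fun h ↦ htop (Submodule.eq_top_of_finrank_eq (h.trans h2.symm))
  omega

/-- A line of a plane is neither `⊥` nor `⊤`. [folklore] -/
theorem ne_bot_and_ne_top_of_finrank_eq_one (h2 : finrank k V = 2) {L : Submodule k V}
    (hL : finrank k L = 1) : L ≠ ⊥ ∧ L ≠ ⊤ := by
  haveI : FiniteDimensional k V := Module.finite_of_finrank_eq_succ h2
  refine ⟨fun h ↦ ?_, fun h ↦ ?_⟩
  · rw [← Submodule.finrank_eq_zero (R := k), hL] at h
    exact one_ne_zero h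
  · rw [h, finrank_top, h2] at hL
    norm_num at hL

end Lines

/-! ### The unipotent case -/

section Unipotent

/-- **The fixed line of a unipotent element of the image is stable.** Let `ρ` be a representation
of `G` on a plane `V` all of whose elements `ρ g` fix a non-zero vector, and let `u = ρ g₁ ≠ 1` be
unipotent, `(u - 1)² = 0`. Then the line `L = ker(u - 1)` is stable under every `ρ g`: otherwise
`M = ρ g (L) ≠ L`, the conjugate `u' = ρ(g g₁ g⁻¹) = 1 + N'` (`N = u - 1`, `N' = ρ g ∘ N ∘ ρ g⁻¹`,
`ker N' ⊇ M ⊇ im N'`) and a non-zero fixed vector `v` of `ρ(g₁ g g₁ g⁻¹) = (1 + N)(1 + N')` give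
`N v + N' v + N N' v = 0`; applying `N` (`N² = 0`) yields `N N' v = 0`, so `N' v ∈ L ∩ M = 0`,
then `N v = 0` and `v ∈ L ∩ M = 0`, a contradiction. [folklore] -/
theorem apply_mem_ker_of_unipotent (ρ : _root_.Representation k G V) (h2 : finrank k V = 2)
    (hfix : ∀ g : G, ∃ v : V, v ≠ 0 ∧ ρ g v = v) {g₁ : G} (hne : ρ g₁ ≠ 1)
    (hsq : (ρ g₁ - 1) * (ρ g₁ - 1) = 0) (g : G) :
    ∀ x ∈ LinearMap.ker (ρ g₁ - 1), ρ g x ∈ LinearMap.ker (ρ g₁ - 1) := by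
  haveI : FiniteDimensional k V := Module.finite_of_finrank_eq_succ h2
  set N : Module.End k V := ρ g₁ - 1 with hN_def
  have hN0 : N ≠ 0 := sub_ne_zero.mpr hne
  obtain ⟨hrange, hL1⟩ := range_eq_ker_of_mul_self_eq_zero h2 hN0 hsq
  -- `ρ g` and `ρ g⁻¹` are mutually inverse
  have hinv1 : ∀ x, ρ g (ρ g⁻¹ x) = x := fun x ↦ by
    rw [← Module.End.mul_apply, ← map_mul, mul_inv_cancel, map_one, Module.End.one_apply]
  have hinv2 : ∀ x, ρ g⁻¹ (ρ g x) = x := fun x ↦ by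
    rw [← Module.End.mul_apply, ← map_mul, inv_mul_cancel, map_one, Module.End.one_apply]
  -- the line `M = ρ g (L)`
  set M : Submodule k V := (LinearMap.ker N).map (ρ g) with hM_def
  have hM1 : finrank k M = 1 := by
    let e : V ≃ₗ[k] V :=
      LinearEquiv.ofLinear (ρ g) (ρ g⁻¹) (LinearMap.ext hinv1) (LinearMap.ext hinv2)
    have he : M = (LinearMap.ker N).map (e : V →ₗ[k] V) := rfl
    rw [he, LinearEquiv.finrank_map_eq, hL1]
  by_contra hcontra
  push Not at hcontra
  obtain ⟨x, hxL, hxnot⟩ := hcontra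
  have hLM : LinearMap.ker N ≠ M := by
    intro hEq
    exact hxnot (hEq ▸ Submodule.mem_map_of_mem hxL)
  -- the conjugate `N' = ρ g ∘ N ∘ ρ g⁻¹`
  set N' : Module.End k V := ρ g * N * ρ g⁻¹ with hN'_def
  have hN'apply : ∀ v, N' v = ρ g (N (ρ g⁻¹ v)) := fun v ↦ rfl
  have hu : ρ g₁ = 1 + N := by rw [hN_def]; abel
  have hconj : ρ (g * g₁ * g⁻¹) = 1 + N' := by
    rw [map_mul, map_mul, hu, hN'_def, mul_add, mul_one, add_mul, ← map_mul ρ g g⁻¹,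
      mul_inv_cancel, map_one]
  -- a fixed vector of `u u'`
  obtain ⟨v, hv0, hv⟩ := hfix (g₁ * (g * g₁ * g⁻¹))
  rw [map_mul, hconj, hu] at hv
  have hNN : ∀ y, N (N y) = 0 := fun y ↦ by
    rw [← Module.End.mul_apply, hsq, LinearMap.zero_apply]
  have key : N' v + N v + N (N' v) = 0 := by
    have h := hv
    simp only [Module.End.mul_apply, LinearMap.add_apply, Module.End.one_apply, map_add] at h
    -- `h : v + N' v + (N v + N (N' v)) = v`
    have h' : v + (N' v + N v + N (N' v)) = v + 0 := by
      rw [add_zero]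
      calc v + (N' v + N v + N (N' v)) = v + N v + (N' v + N (N' v)) := by abel
        _ = v := h
    exact add_left_cancel h'
  have key2 : N (N' v) = 0 := by
    have h := congr_arg N key
    rwa [map_add, map_add, hNN, hNN, map_zero, add_zero, add_zero] at h
  -- `N' v ∈ L ∩ M`, hence `N' v = 0`
  have hN'vL : N' v ∈ LinearMap.ker N := key2
  have hN'vM : N' v ∈ M := by
    rw [hN'apply]
    refine Submodule.mem_map_of_mem ?_
    rw [← hrange]
    exact LinearMap.mem_range_self N _
  have hN'v0 : N' v = 0 := by
    by_contra h
    exact hLM (eq_of_finrank_eq_one_of_mem hL1 hM1 h hN'vL hN'vM)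
  -- hence `N v = 0`: `v ∈ L ∩ M`, `v ≠ 0`, contradiction
  have hNv0 : N v = 0 := by
    rw [hN'v0, map_zero, zero_add, add_zero] at key
    exact key
  have hvL : v ∈ LinearMap.ker N := hNv0
  have hvM : v ∈ M := by
    have h1 : N (ρ g⁻¹ v) = 0 := by
      have h := congr_arg (ρ g⁻¹) hN'v0
      rwa [hN'apply, hinv2, map_zero] at h
    rw [← hinv1 v]
    exact Submodule.mem_map_of_mem (f := ρ g) h1
  exact hLM (eq_of_finrank_eq_one_of_mem hL1 hM1 hv0 hvL hvM)

end Unipotent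

/-! ### The case without unipotents: the image is abelian -/

section NoUnipotent

/-- **An endomorphism of a plane with determinant `1` and a non-zero fixed vector is unipotent**:
its characteristic polynomial is monic of degree `2` with constant coefficient `det f = 1` and has
the root `1`, hence equals `(X - 1)²`, and Cayley–Hamilton gives `(f - 1)² = 0`. [folklore] -/
theorem mul_self_sub_one_eq_zero_of_det_eq_one (h2 : finrank k V = 2) {f : Module.End k V}
    (hdet : LinearMap.det f = 1) {v : V} (hv0 : v ≠ 0) (hv : f v = v) :
    (f - 1) * (f - 1) = 0 := by
  haveI : FiniteDimensional k V := Module.finite_of_finrank_eq_succ h2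
  set p : k[X] := f.charpoly with hp
  have hmonic : p.Monic := f.charpoly_monic
  have hdeg : p.natDegree = 2 := by rw [hp, f.charpoly_natDegree, h2]
  have hc0 : p.coeff 0 = 1 := by
    have h := LinearMap.det_eq_sign_charpoly_coeff f
    rw [hdet, h2] at h
    rw [hp]
    linear_combination -h
  have hroot : p.IsRoot 1 := by
    rw [hp, ← Module.End.hasEigenvalue_iff_isRoot_charpoly]
    exact Module.End.hasEigenvalue_of_hasEigenvector
      (Module.End.hasEigenvector_iff.mpr
        ⟨Module.End.mem_eigenspace_iff.mpr (by rw [hv, one_smul]), hv0⟩)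
  have hsum : p = X ^ 2 + C (p.coeff 1) * X + C (p.coeff 0) := by
    conv_lhs => rw [hmonic.as_sum, hdeg]
    simp only [Finset.sum_range_succ, Finset.sum_range_zero, zero_add, pow_zero, mul_one,
      pow_one]
    ring
  have hc1 : p.coeff 1 = -2 := by
    have h := hroot
    rw [Polynomial.IsRoot, hsum] at h
    simp only [eval_add, eval_pow, eval_X, eval_mul, eval_C, one_pow, mul_one] at h
    rw [hc0] at h
    linear_combination h
  have hCH := f.aeval_self_charpoly
  rw [← hp, hsum, hc1, hc0] at hCH
  -- `hCH : f² - 2 f + 1 = 0`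
  apply LinearMap.ext
  intro x
  have hx := congr_arg (fun T : Module.End k V ↦ T x) hCH
  simp only [map_add, map_mul, aeval_X, aeval_C, LinearMap.add_apply, Module.End.mul_apply,
    LinearMap.zero_apply, Module.algebraMap_end_apply, pow_two, one_smul] at hx
  -- `hx : f (f x) + (-2) • f x + x = 0`
  rw [neg_smul, two_smul] at hx
  have hgoal : (f - 1) ((f - 1) x) = f (f x) + -(f x + f x) + x := by
    simp only [LinearMap.sub_apply, Module.End.one_apply, map_sub]
    abel
  rw [Module.End.mul_apply, hgoal, hx, LinearMap.zero_apply]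

/-- **If the image has no non-trivial unipotent, some line is stable.** Under the standing
hypothesis (every `ρ g` fixes a non-zero vector) and the absence of unipotents `≠ 1` in the
image, every `ρ c` with `det ρ c = 1` is trivial (`mul_self_sub_one_eq_zero_of_det_eq_one`), in
particular every commutator, so the image of `ρ` is abelian and the fixed line `ker(ρ g₀ - 1)`
of a non-trivial `ρ g₀` is stable under all `ρ g` (if the image is trivial, any line is).
[folklore] -/
theorem exists_finrank_eq_one_invariant_of_forall_ne (ρ : _root_.Representation k G V)
    (h2 : finrank k V = 2) (hfix : ∀ g : G, ∃ v : V, v ≠ 0 ∧ ρ g v = v)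
    (hU : ∀ g : G, ρ g ≠ 1 → (ρ g - 1) * (ρ g - 1) ≠ 0) :
    ∃ L : Submodule k V, finrank k L = 1 ∧ ∀ g : G, ∀ x ∈ L, ρ g x ∈ L := by
  haveI : FiniteDimensional k V := Module.finite_of_finrank_eq_succ h2
  -- elements of determinant one in the image are trivial
  have hdet1 : ∀ g : G, LinearMap.det (ρ g) = 1 → ρ g = 1 := by
    intro g hg
    by_contra hne
    obtain ⟨v, hv0, hv⟩ := hfix g
    exact hU g hne (mul_self_sub_one_eq_zero_of_det_eq_one h2 hg hv0 hv)
  have hdetinv : ∀ g : G, LinearMap.det (ρ g) * LinearMap.det (ρ g⁻¹) = 1 := fun g ↦ by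
    rw [← map_mul, ← map_mul, mul_inv_cancel, map_one, map_one]
  -- hence the image is abelian
  have hcomm : ∀ g h : G, ρ g * ρ h = ρ h * ρ g := by
    intro g h
    have hc : ρ (g * h * g⁻¹ * h⁻¹) = 1 := by
      apply hdet1
      simp only [map_mul]
      calc LinearMap.det (ρ g) * LinearMap.det (ρ h) * LinearMap.det (ρ g⁻¹) *
            LinearMap.det (ρ h⁻¹)
          = (LinearMap.det (ρ g) * LinearMap.det (ρ g⁻¹)) *
            (LinearMap.det (ρ h) * LinearMap.det (ρ h⁻¹)) := by ring
        _ = 1 := by rw [hdetinv, hdetinv, mul_one]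
    calc ρ g * ρ h = ρ (g * h) := (map_mul ρ g h).symm
      _ = ρ (g * h * g⁻¹ * h⁻¹ * (h * g)) := by congr 1; group
      _ = ρ h * ρ g := by rw [map_mul, hc, one_mul, map_mul]
  by_cases htriv : ∀ g : G, ρ g = 1
  · -- trivial image: any line
    haveI : Nontrivial V := Module.nontrivial_of_finrank_pos (R := k) (by omega)
    obtain ⟨v, hv0⟩ := exists_ne (0 : V)
    refine ⟨k ∙ v, finrank_span_singleton hv0, fun g x hx ↦ ?_⟩
    rw [htriv g, Module.End.one_apply]
    exact hx
  · push Not at htriv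
    obtain ⟨g₀, hg₀⟩ := htriv
    have hmem : ∀ x, x ∈ LinearMap.ker (ρ g₀ - 1) ↔ ρ g₀ x = x := fun x ↦ by
      rw [LinearMap.mem_ker, LinearMap.sub_apply, Module.End.one_apply, sub_eq_zero]
    refine ⟨LinearMap.ker (ρ g₀ - 1), ?_, fun g x hx ↦ ?_⟩
    · obtain ⟨v, hv0, hv⟩ := hfix g₀
      refine finrank_eq_one_of_ne_bot_of_ne_top h2 (fun h ↦ hv0 ?_) (fun h ↦ hg₀ ?_)
      · have hv' := (hmem v).mpr hv
        rw [h] at hv'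
        exact (Submodule.mem_bot k).mp hv'
      · rw [← sub_eq_zero, ← LinearMap.ker_eq_top]
        exact h
    · rw [hmem] at hx ⊢
      rw [← Module.End.mul_apply, hcomm, Module.End.mul_apply, hx]

end NoUnipotent

/-! ### Assembly -/

section Main

/-- **A plane representation all of whose elements fix a non-zero vector has an invariant
line.** Let `k` be a field, `V` a `k`-vector space of dimension `2`, `G` a group and
`ρ : Representation k G V`. If for every `g ∈ G` there is `v ≠ 0` with `ρ g v = v` (i.e. `1` is
an eigenvalue of every element of the image), then there is a line `L ⊆ V` (`dim L = 1`) with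
`ρ g (L) ⊆ L` for all `g`. (Dimension-`2` case, in the unipotent-or-abelian form proved in this
file, of the Brauer–Nesbitt principle that a semisimple representation is determined by its
characteristic polynomials: under the hypothesis every `ρ g` has characteristic polynomial
`(X - 1)(X - det ρ g)`, that of `1 ⊕ det ρ`.) [folklore] -/
theorem exists_finrank_eq_one_invariant_of_forall_exists_fixed (ρ : _root_.Representation k G V)
    (h2 : finrank k V = 2) (hfix : ∀ g : G, ∃ v : V, v ≠ 0 ∧ ρ g v = v) :
    ∃ L : Submodule k V, finrank k L = 1 ∧ ∀ g : G, ∀ x ∈ L, ρ g x ∈ L := by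
  by_cases hU : ∃ g : G, ρ g ≠ 1 ∧ (ρ g - 1) * (ρ g - 1) = 0
  · obtain ⟨g₁, hne, hsq⟩ := hU
    have hN0 : ρ g₁ - 1 ≠ 0 := sub_ne_zero.mpr hne
    exact ⟨LinearMap.ker (ρ g₁ - 1), (range_eq_ker_of_mul_self_eq_zero h2 hN0 hsq).2,
      fun g ↦ apply_mem_ker_of_unipotent ρ h2 hfix hne hsq g⟩
  · push Not at hU
    exact exists_finrank_eq_one_invariant_of_forall_ne ρ h2 hfix hU

/-- The invariant line of `exists_finrank_eq_one_invariant_of_forall_exists_fixed` as a proper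
non-zero invariant submodule. [folklore] -/
theorem exists_ne_bot_ne_top_invariant_of_forall_exists_fixed (ρ : _root_.Representation k G V)
    (h2 : finrank k V = 2) (hfix : ∀ g : G, ∃ v : V, v ≠ 0 ∧ ρ g v = v) :
    ∃ L : Submodule k V, L ≠ ⊥ ∧ L ≠ ⊤ ∧ ∀ g : G, ∀ x ∈ L, ρ g x ∈ L := by
  obtain ⟨L, hL1, hL⟩ := exists_finrank_eq_one_invariant_of_forall_exists_fixed ρ h2 hfix
  exact ⟨L, (ne_bot_and_ne_top_of_finrank_eq_one h2 hL1).1,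
    (ne_bot_and_ne_top_of_finrank_eq_one h2 hL1).2, hL⟩

/-- In Mathlib's language: a representation on a plane all of whose elements fix a non-zero
vector is **not irreducible** (`Representation.IsIrreducible` = the subrepresentations form a
simple order). [folklore] -/
theorem not_isIrreducible_of_forall_exists_fixed (ρ : _root_.Representation k G V)
    (h2 : finrank k V = 2) (hfix : ∀ g : G, ∃ v : V, v ≠ 0 ∧ ρ g v = v) :
    ¬ ρ.IsIrreducible := by
  obtain ⟨L, hbot, htop, hL⟩ := exists_ne_bot_ne_top_invariant_of_forall_exists_fixed ρ h2 hfix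
  intro hirr
  rcases hirr.eq_bot_or_eq_top ⟨L, fun g _ hv ↦ hL g _ hv⟩ with h | h
  · exact hbot (congr_arg Subrepresentation.toSubmodule h)
  · exact htop (congr_arg Subrepresentation.toSubmodule h)

end Main

/-! ### Galois-module form: `𝔽_p`-planes with a distributive group action -/

section ZModPlane

variable {p : ℕ} [Fact p.Prime] {A : Type*} [AddCommGroup A] [Module (ZMod p) A]
  {Γ : Type*} [Group Γ] [DistribMulAction Γ A]

/-- **Galois-module form.** Let `A` be an `𝔽_p`-vector space of dimension `2` with an action of
a group `Γ` by additive automorphisms (e.g. `A = E[p]` with its `Γ_ℚ`-action). If every `σ ∈ Γ`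
fixes a non-zero element of `A`, then `A` has a `Γ`-stable subgroup other than `⊥` and `⊤` — the
negation of irreducibility in the sense of `WeierstrassCurve.HasIrreducibleModPGaloisRep`.
[folklore] -/
theorem exists_stable_addSubgroup_of_forall_exists_fixed (h2 : finrank (ZMod p) A = 2)
    (hfix : ∀ σ : Γ, ∃ a : A, a ≠ 0 ∧ σ • a = a) :
    ∃ H : AddSubgroup A, (∀ σ : Γ, ∀ a ∈ H, σ • a ∈ H) ∧ H ≠ ⊥ ∧ H ≠ ⊤ := by
  -- the `𝔽_p`-linear representation underlying the action (additive maps are `𝔽_p`-linear,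
  -- Mathlib `AddMonoidHom.toZModLinearMap`)
  let ρ : _root_.Representation (ZMod p) Γ A :=
    { toFun := fun σ ↦ (DistribSMul.toAddMonoidHom A σ).toZModLinearMap p
      map_one' := by ext; simp
      map_mul' := fun σ τ ↦ by ext; simp [mul_smul] }
  have hfix' : ∀ σ : Γ, ∃ a : A, a ≠ 0 ∧ ρ σ a = a := hfix
  obtain ⟨L, hbot, htop, hL⟩ := exists_ne_bot_ne_top_invariant_of_forall_exists_fixed ρ h2 hfix'
  refine ⟨L.toAddSubgroup, fun σ a ha ↦ hL σ a ha, fun h ↦ hbot ?_, fun h ↦ htop ?_⟩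
  · rw [← Submodule.toAddSubgroup_inj, h, Submodule.bot_toAddSubgroup]
  · exact Submodule.toAddSubgroup_eq_top.mp h

/-- `#A = p² ⇒ dim_{𝔽_p} A = 2` (`p` prime; `#A = p ^ dim A`). With the tree's
`WeierstrassCurve.card_torsionBy_eq_sq` (`#E[p] = p²`) this verifies the dimension hypothesis for
`A = E[p]`. [folklore] -/
theorem finrank_eq_two_of_natCard_eq_sq (hA : Nat.card A = p ^ 2) :
    finrank (ZMod p) A = 2 := by
  have hp : p.Prime := Fact.out
  haveI : Finite A := Nat.finite_of_card_ne_zero (by rw [hA]; exact pow_ne_zero 2 hp.ne_zero)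
  haveI : Module.Finite (ZMod p) A := Module.Finite.of_finite
  have h := Module.natCard_eq_pow_finrank (K := ZMod p) (V := A)
  rw [hA, Nat.card_zmod] at h
  exact (Nat.pow_right_injective hp.two_le h).symm

/-- **Galois-module form, cardinality version**: an `𝔽_p`-module `A` with `p²` elements
(`p` prime) acted on by `Γ` through additive automorphisms each fixing a non-zero element has a
`Γ`-stable subgroup other than `⊥` and `⊤`. [folklore] -/
theorem exists_stable_addSubgroup_of_natCard_eq_sq (hA : Nat.card A = p ^ 2)
    (hfix : ∀ σ : Γ, ∃ a : A, a ≠ 0 ∧ σ • a = a) :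
    ∃ H : AddSubgroup A, (∀ σ : Γ, ∀ a ∈ H, σ • a ∈ H) ∧ H ≠ ⊥ ∧ H ≠ ⊤ :=
  exists_stable_addSubgroup_of_forall_exists_fixed (finrank_eq_two_of_natCard_eq_sq hA) hfix

end ZModPlane

end Literature.RepresentationTheory.FiniteGroups.Representation
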